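import Literature.Computability.AlgebraicComplexity.DDS21BorderPITExistenceProofs
import Literature.Barriers.ValiantsHypothesis.GKSS17FSVPresentation
import HarnessLib

/-!
# Dutta–Dwivedi–Saxena 2021, Thm. 6.8 AS TYPED (existence of hitting sets for the border of
# `Σ^{[k]}ΠΣ∧` and `Σ^{[k]}ΠΣΠ^{[δ]}`) — discharged by the Heintz–Schnorr existence theorem

Topic: `Literature/Computability/AlgebraicComplexity` (theorem-only; discharges the named fact
`DDS2021_thm_6_8` of `DDS21BorderDepthThree.lean`; sequel of `DDS21BorderPITExistenceProofs.lean`,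
whose `DDS21PIT.padFin` is reused).

HONEST FRAMING (lead-np RULINGS (84)(a)/(85)(f), val-lit 2026-08-27). `DDS2021_thm_6_8` is typed
"WEAKER than print (explicitness dropped; the proof is printed as a sketch, §6.2)": both clauses
assert the EXISTENCE of a hitting set of the printed SIZE for the border classes
`\overline{Σ^{[k]}ΠΣ∧}` and `\overline{Σ^{[k]}ΠΣΠ^{[δ]}}` within budget `s`, whereas print gives
EXPLICIT `s^{O(k7^k log log s)}`- resp. `s^{O(δ²k7^k log s)}`-time hitting sets via DiDIL. As typed,
both are instances of the Heintz–Schnorr existence theorem [HS80, Thm. 4.4] for the closure of a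
polynomially parametrised class
(`Literature.Computability.AlgebraicComplexity.BorderHittingSets.exists_hittingSet_border`, the
CKRST20 §3.1 rewording): generic members with `k·s·(1 + n(s+1))` resp. `k·s·binom(n+δ, δ)`
indeterminate coefficients — the sparsity bound `m` of the bottom `ΣΠ^{[δ]}` layer is simply
DROPPED (the class of all bottom polynomials of degree `≤ δ` is a superset with polynomially many
parameters for fixed `δ`, `binom(n+δ,δ) ≤ (n+δ)^δ ≤ s^{2δ}`), which is why the count stays inside
the typed `s^{c(δ+1)²k7^k(log s+1)}`. THIS PROOF IS EXISTENCE-FORM: DDS's explicit constructions,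
running times and bit complexity are NOT captured (no cost model); `DDS2021_thm_5_1` (de-bordering
`Σ^{[k]}ΠΣ∧`) is untouched. Nothing here bears on VP versus VNP, which is NOT proved.

## What is proved

* `DDS21PIT.spswGeneric` (`Σ^{[k]}Π^{[d]}ΣΛ^{[≤ s]}`: univariate bottom polynomials with all
  `s + 1` coefficients indeterminate; parameters `(Fin k × Fin s) ⊕ (Fin k × Fin s × Fin n × Fin (s+1))`)
  and `DDS21PIT.spspGeneric` (`Σ^{[k]}Π^{[d]}ΣΠ^{[δ]}` with ALL monomials of degree `≤ δ`;
  parameters `Fin k × Fin s × degLE n δ`), one piece per `d ≤ s`, with membership lemmas.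
* `DDS21PIT.card_degLE` — `#{monomials of degree ≤ δ in n variables} = binom(n+δ, δ)`, by name
  from `Literature.Barriers.ValiantsHypothesis.GKSS2017.ncard_degLE`.
* `DDS2021_thm_6_8_holds` (constants `c = 7` and `c = 3`).

## References

* [DuttaDwivediSaxena2022] P. Dutta, P. Dwivedi, N. Saxena, *Demystifying the border of depth-3
  algebraic circuits*, FOCS 2021; full version `paper:galaxy-pdf-7641649743695546420`: Thm. 6.8
  (p0048 L1270–1272), §5 Thm. 5.1 (p0043 L1144–1150), §6.2 (p0048 L1265–1269).
* [HeintzSchnorr1980] J. Heintz, C.-P. Schnorr, *Testing polynomials which are easy to compute*,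
  STOC 1980, Thm. 4.4; [ChatterjeeKumarRamyaSaptharishiTengse2020] arXiv v4 §3.1 Thms. 3.2–3.3.
* [ForbesShpilkaVolk2018] Cor. 5 (`N = binom(n+d, d)`, the monomial count reused by name).
-/

noncomputable section

open MvPolynomial
open scoped BigOperators

namespace Literature.Computability.AlgebraicComplexity

namespace DDS21PIT

open BorderHittingSets DDS2021 HittingSets

variable {F : Type} [Field F]

/-! ## Padding finite index ranges (`DDS21PIT.padFin` of the prequel) -/

/-- `padFin` agrees with `α` on the embedded range. [folklore] -/
private theorem padFin_castLE' {β : Type*} {d s : ℕ} (hd : d ≤ s) (α : Fin d → β) (z : β)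
    (j : Fin d) : padFin α z (Fin.castLE hd j) = α j := by
  simp [padFin, j.2]

/-! ## `Σ^{[k]}ΠΣ∧`: the generic member -/

section SPSW

variable (F)

/-- Parameter index of the `Σ^{[k]}Π^{[≤ s]}ΣΛ` generic members: `inl (i, j)` the constant term of the
`(i, j)`-th factor, `inr (i, j, m, l)` the coefficient of `x_m^l` in it (DDS §5:
"`f = Σ_i Π_j (c_{ij} + Σ_m p_{ijm}(x_m))`", `deg p_{ijm} ≤ e ≤ s`).
[cite: DuttaDwivediSaxena2022, §5 Thm. 5.1 (full version p0043, L1144–1150)] -/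
abbrev SpswIdx (n k s : ℕ) : Type := (Fin k × Fin s) ⊕ (Fin k × Fin s × Fin n × Fin (s + 1))

/-- The generic `Σ^{[k]}Π^{[d]}ΣΛ` member with `d = jd ≤ s` factors and univariate bottom
polynomials of degree `≤ s`. [cite: DuttaDwivediSaxena2022, §5 Thm. 5.1 (full version p0043, L1144–1150)] -/
def spswGeneric (n k s : ℕ) (jd : Fin (s + 1)) :
    MvPolynomial (Fin n) (MvPolynomial (SpswIdx n k s) F) :=
  ∑ i : Fin k, ∏ j : Fin (jd : ℕ),
    (C (X (Sum.inl (i, Fin.castLE (Nat.lt_succ_iff.mp jd.2) j))) +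
      ∑ m : Fin n, ∑ l : Fin (s + 1),
        C (X (Sum.inr (i, Fin.castLE (Nat.lt_succ_iff.mp jd.2) j, m, l))) * X m ^ (l : ℕ))

variable {F}

/-- A univariate polynomial of degree `≤ s` in `x_m`, written on the powers `x_m^l`, `l ≤ s`.
[folklore] -/
private theorem aeval_X_eq_sum_fin {L : Type*} [CommSemiring L] {n s : ℕ} (m : Fin n)
    {q : Polynomial L} (hq : q.natDegree < s + 1) :
    Polynomial.aeval (X m : MvPolynomial (Fin n) L) q =
      ∑ l : Fin (s + 1), C (q.coeff l) * X m ^ (l : ℕ) := by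
  rw [Polynomial.aeval_eq_sum_range' hq,
    ← Fin.sum_univ_eq_sum_range (fun l => q.coeff l • (X m : MvPolynomial (Fin n) L) ^ l) (s + 1)]
  simp only [smul_eq_C_mul]

/-- A `Σ^{[k]}ΠΣ∧` polynomial over `F(ε)` with `d ≤ s` factors and bottom degrees `≤ e ≤ s` is a
member of the generic family (piece `d`). [cite: DuttaDwivediSaxena2022, §5 Thm. 5.1 (full version p0043, L1144–1150)] -/
theorem isMember_spswGeneric_of_mem_spswClass {n k s d e : ℕ} (hd : d ≤ s) (he : e ≤ s)
    {g : MvPolynomial (Fin n) (RatFunc F)} (hg : g ∈ spswClass (RatFunc F) n k d e) :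
    IsMember (spswGeneric F n k s) (RatFunc F) g := by
  obtain ⟨c, p, hp, rfl⟩ := hg
  refine ⟨⟨d, Nat.lt_succ_of_le hd⟩,
    Sum.elim (fun q => padFin (c q.1) 0 q.2)
      (fun q => padFin (fun j => (p q.1 j q.2.2.1).coeff q.2.2.2) 0 q.2.1), ?_⟩
  simp only [spswGeneric, map_sum, map_prod, map_add, map_mul, map_pow, map_C, map_X,
    AlgHom.toRingHom_eq_coe, RingHom.coe_coe, aeval_X, Sum.elim_inl, Sum.elim_inr,
    padFin_castLE' hd]
  refine Finset.sum_congr rfl fun i _ => Finset.prod_congr rfl fun j _ => ?_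
  congr 1
  refine Finset.sum_congr rfl fun m _ => ?_
  exact aeval_X_eq_sum_fin m (Nat.lt_succ_of_le ((hp i j m).trans he))

end SPSW

/-! ## Monomials of degree `≤ δ` -/

section DegLE

/-- The monomials of degree `≤ δ` in `n` variables, as a `Finset` (Mathlib
`Finsupp.finite_of_degree_le`). [folklore] -/
def degLE (n δ : ℕ) : Finset (Fin n →₀ ℕ) :=
  (Finsupp.finite_of_degree_le (σ := Fin n) δ).toFinset

/-- Membership in `degLE`. [folklore] -/
private theorem mem_degLE {n δ : ℕ} {μ : Fin n →₀ ℕ} : μ ∈ degLE n δ ↔ μ.degree ≤ δ := by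
  rw [degLE, Set.Finite.mem_toFinset]; rfl

/-- **`#degLE n δ = binom(n + δ, δ)`**, by name from the tree's
`Literature.Barriers.ValiantsHypothesis.GKSS2017.ncard_degLE` (FSV: "`N = binom(n+d, d)`").
[cite: ForbesShpilkaVolk2018, Cor. 5] -/
theorem card_degLE (n δ : ℕ) : (degLE n δ).card = (n + δ).choose δ := by
  have h1 : (degLE n δ).card = Set.ncard {μ : Fin n →₀ ℕ | μ.degree ≤ δ} :=
    (Set.ncard_eq_toFinset_card _ _).symm
  rw [h1, ← Nat.card_coe_set_eq]
  exact Literature.Barriers.ValiantsHypothesis.GKSS2017.ncard_degLE n δ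

/-- A polynomial of degree `≤ δ` written on the monomials of degree `≤ δ`. [folklore] -/
private theorem eq_sum_degLE {L : Type*} [CommSemiring L] {n δ : ℕ} {q : MvPolynomial (Fin n) L}
    (hq : q.totalDegree ≤ δ) :
    q = ∑ μ : degLE n δ, C (coeff (μ : Fin n →₀ ℕ) q) * monomial (μ : Fin n →₀ ℕ) 1 := by
  classical
  ext ν
  simp only [coeff_sum, C_mul_monomial, mul_one, coeff_monomial]
  by_cases hν : ν.degree ≤ δ
  · rw [Finset.sum_eq_single ⟨ν, mem_degLE.mpr hν⟩]
    · simp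
    · intro μ _ hμ
      rw [if_neg]
      exact fun h => hμ (Subtype.ext h)
    · intro h; exact absurd (Finset.mem_univ _) h
  · rw [Finset.sum_eq_zero]
    · have hlt : q.totalDegree < ν.degree := by omega
      rw [Finsupp.degree_apply] at hlt
      exact coeff_eq_zero_of_totalDegree_lt hlt
    · intro μ _
      rw [if_neg]
      intro h
      exact hν (h ▸ mem_degLE.mp μ.2)

end DegLE

/-! ## `Σ^{[k]}ΠΣΠ^{[δ]}`: the generic member -/

section SPSP

variable (F)

/-- Parameter index of the `Σ^{[k]}Π^{[≤ s]}ΣΠ^{[δ]}` generic members: the coefficient of the monomial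
`μ` (`|μ| ≤ δ`) in the `(i, j)`-th bottom polynomial (DDS §6.2: "`f = Σ_{i∈[k]} Π_j g_{ij}` where
`deg(g_{ij}) ≤ δ`"). [cite: DuttaDwivediSaxena2022, §1.1 and §6.2 (full version p0007 L149–151)] -/
abbrev SpspIdx (n k s δ : ℕ) : Type := Fin k × Fin s × degLE n δ

/-- The generic `Σ^{[k]}Π^{[d]}ΣΠ^{[δ]}` member with `d = jd ≤ s` factors:
`Σ_i Π_j Σ_{|μ| ≤ δ} a_{i,j,μ} x^μ`. [cite: DuttaDwivediSaxena2022, §1.1 and §6.2 (full version p0007 L149–151)] -/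
def spspGeneric (n k s δ : ℕ) (jd : Fin (s + 1)) :
    MvPolynomial (Fin n) (MvPolynomial (SpspIdx n k s δ) F) :=
  ∑ i : Fin k, ∏ j : Fin (jd : ℕ), ∑ μ : degLE n δ,
    C (X (i, Fin.castLE (Nat.lt_succ_iff.mp jd.2) j, μ)) * monomial (μ : Fin n →₀ ℕ) 1

variable {F}

/-- A `Σ^{[k]}ΠΣΠ^{[δ]}` polynomial over `F(ε)` with `d ≤ s` factors (any sparsity) is a member of
the generic family (piece `d`). [cite: DuttaDwivediSaxena2022, §1.1 and §6.2 (full version p0007 L149–151)] -/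
theorem isMember_spspGeneric_of_mem_spspClass {n k s δ d m : ℕ} (hd : d ≤ s)
    {g : MvPolynomial (Fin n) (RatFunc F)} (hg : g ∈ spspClass (RatFunc F) n k d δ m) :
    IsMember (spspGeneric F n k s δ) (RatFunc F) g := by
  obtain ⟨q, hq, rfl⟩ := hg
  refine ⟨⟨d, Nat.lt_succ_of_le hd⟩,
    fun p => padFin (fun j => coeff (p.2.2 : Fin n →₀ ℕ) (q p.1 j)) 0 p.2.1, ?_⟩
  simp only [spspGeneric, map_sum, map_prod, map_mul, map_C, map_monomial, map_one,
    AlgHom.toRingHom_eq_coe, RingHom.coe_coe, aeval_X, padFin_castLE' hd]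
  refine Finset.sum_congr rfl fun i _ => Finset.prod_congr rfl fun j _ => ?_
  exact eq_sum_degLE (hq i j).1

end SPSP

/-! ## Arithmetic of the size bounds -/

/-- `s^a + 1 ≤ s^{a+1}` for `s ≥ 2`. [folklore] -/
private theorem pow_add_one_le {s : ℕ} (hs : 2 ≤ s) (a : ℕ) : s ^ a + 1 ≤ s ^ (a + 1) := by
  have h1 : 1 ≤ s ^ a := Nat.one_le_pow _ _ (by omega)
  calc s ^ a + 1 ≤ s ^ a + s ^ a := by omega
    _ = s ^ a * 2 := by ring
    _ ≤ s ^ a * s := Nat.mul_le_mul_left _ hs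
    _ = s ^ (a + 1) := by ring

/-- The parameter count of `Σ^{[k]}Π^{[≤ s]}ΣΛ`: `k·s + k·s·n·(s+1) + 1 ≤ s^7`. [folklore] -/
private theorem spsw_count_le {n k s : ℕ} (hk : k ≤ s) (hn : n ≤ s) (hs : 2 ≤ s) :
    k * s + k * (s * (n * (s + 1))) + 1 ≤ s ^ 7 := by
  have h1 : k * s + k * (s * (n * (s + 1))) ≤ s * s + s * (s * (s * (s + 1))) := by gcongr
  have h4 : 4 ≤ s * s := Nat.mul_le_mul hs hs
  have h2 : s * s + s * (s * (s * (s + 1))) ≤ s ^ 6 := by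
    have e1 : s * s + s * (s * (s * (s + 1))) = s ^ 2 + s ^ 4 + s ^ 3 := by ring
    have e2 : s ^ 6 = s ^ 2 * s ^ 4 := by ring
    rw [e1, e2]
    have h5 : s ^ 2 ≤ s ^ 4 := Nat.pow_le_pow_right (by omega) (by norm_num)
    have h6 : s ^ 3 ≤ s ^ 4 := Nat.pow_le_pow_right (by omega) (by norm_num)
    have h7 : 3 * s ^ 4 ≤ s ^ 2 * s ^ 4 := Nat.mul_le_mul_right _ (by rw [pow_two]; omega)
    omega
  calc k * s + k * (s * (n * (s + 1))) + 1 ≤ s ^ 6 + 1 := by omega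
    _ ≤ s ^ 7 := pow_add_one_le hs 6

/-- The parameter count of `Σ^{[k]}Π^{[≤ s]}ΣΠ^{[δ]}`: `k·s·binom(n+δ,δ) + 1 ≤ s^{2δ+3}`. [folklore] -/
private theorem spsp_count_le {n k s δ : ℕ} (hk : k ≤ s) (hn : n ≤ s) (hδ : δ ≤ s) (hs : 2 ≤ s) :
    k * (s * (n + δ).choose δ) + 1 ≤ s ^ (2 * δ + 3) := by
  have hc : (n + δ).choose δ ≤ s ^ (2 * δ) := by
    calc (n + δ).choose δ ≤ (n + δ) ^ δ := Nat.choose_le_pow _ _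
      _ ≤ (s * s) ^ δ := by
          refine Nat.pow_le_pow_left ?_ _
          nlinarith
      _ = s ^ (2 * δ) := by rw [← pow_two, ← pow_mul]
  have h1 : k * (s * (n + δ).choose δ) ≤ s * (s * s ^ (2 * δ)) := by gcongr
  calc k * (s * (n + δ).choose δ) + 1 ≤ s * (s * s ^ (2 * δ)) + 1 := by omega
    _ = s ^ (2 * δ + 2) + 1 := by ring
    _ ≤ s ^ (2 * δ + 3) := pow_add_one_le hs _

end DDS21PIT

open BorderHittingSets DDS2021 HittingSets DDS21PIT

/-! ## The discharge -/

/-- **DDS Thm. 6.8 AS TYPED — hitting sets for `\overline{Σ^{[k]}ΠΣ∧}` and `\overline{Σ^{[k]}ΠΣΠ^{[δ]}}`,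
existence form.** Typed weaker than print (explicitness dropped; the printed proof is a sketch);
this proof is existence-form: both clauses are instances of the Heintz–Schnorr existence theorem
[HS80, Thm. 4.4] / [CKRST20, §3.1 Thm. 3.3] for the border of a polynomially parametrised class
(`BorderHittingSets.exists_hittingSet_border`): `k·s·(1 + n(s+1)) + 1 ≤ s^7` points for
`Σ^{[k]}ΠΣΛ` (`c = 7`) and `k·s·binom(n+δ,δ) + 1 ≤ s^{2δ+3}` points for `Σ^{[k]}ΠΣΠ^{[δ]}` with the
sparsity bound dropped (`c = 3`). DDS's explicit `s^{O(k7^k log log s)}` / `s^{O(δ²k7^k log s)}`-time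
constructions are NOT captured — no cost model.
[cite: DuttaDwivediSaxena2022, Thm. 6.8 (full version p0048, L1270–1272)] -/
theorem DDS2021_thm_6_8_holds : DDS2021_thm_6_8 := by
  refine ⟨⟨7, fun F _ _ n k s hk hks hns hs => ?_⟩, ⟨3, fun F _ _ n k δ s hk hks hδ hns hs => ?_⟩⟩
  · obtain ⟨H, hcard, hH⟩ := exists_hittingSet_border (K := F) (spswGeneric F n k s)
    refine ⟨H, ?_, ?_⟩
    · calc H.card ≤ Fintype.card (SpswIdx n k s) + 1 := hcard
        _ = k * s + k * (s * (n * (s + 1))) + 1 := by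
            simp [Fintype.card_sum, Fintype.card_prod, Fintype.card_fin]
        _ ≤ s ^ 7 := spsw_count_le hks hns hs
        _ ≤ s ^ (7 * k * 7 ^ k * (Nat.log 2 (Nat.log 2 s) + 1)) := by
            refine Nat.pow_le_pow_right (by omega) ?_
            have h7 : 0 < 7 ^ k := by positivity
            have hpos : 0 < k * 7 ^ k * (Nat.log 2 (Nat.log 2 s) + 1) := by positivity
            calc 7 ≤ 7 * (k * 7 ^ k * (Nat.log 2 (Nat.log 2 s) + 1)) :=
                  Nat.le_mul_of_pos_right _ hpos
              _ = 7 * k * 7 ^ k * (Nat.log 2 (Nat.log 2 s) + 1) := by ring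
    · intro f hf hf0
      obtain ⟨d, e, hd, he, g, hg, hfg⟩ := hf
      exact hH f hf0 ⟨g, isMember_spswGeneric_of_mem_spswClass hd he hg, hfg⟩
  · obtain ⟨H, hcard, hH⟩ := exists_hittingSet_border (K := F) (spspGeneric F n k s δ)
    refine ⟨H, ?_, ?_⟩
    · calc H.card ≤ Fintype.card (SpspIdx n k s δ) + 1 := hcard
        _ = k * (s * (n + δ).choose δ) + 1 := by
            simp [Fintype.card_prod, Fintype.card_fin, Fintype.card_coe, card_degLE]
        _ ≤ s ^ (2 * δ + 3) := spsp_count_le hks hns hδ hs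
        _ ≤ s ^ (3 * (δ + 1) ^ 2 * k * 7 ^ k * (Nat.log 2 s + 1)) := by
            refine Nat.pow_le_pow_right (by omega) ?_
            have h7 : 0 < 7 ^ k := by positivity
            have hpos : 0 < k * 7 ^ k * (Nat.log 2 s + 1) := by positivity
            calc 2 * δ + 3 ≤ 3 * (δ + 1) ^ 2 := by nlinarith
              _ ≤ 3 * (δ + 1) ^ 2 * (k * 7 ^ k * (Nat.log 2 s + 1)) :=
                  Nat.le_mul_of_pos_right _ hpos
              _ = 3 * (δ + 1) ^ 2 * k * 7 ^ k * (Nat.log 2 s + 1) := by ring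
    · intro f hf hf0
      obtain ⟨d, m, hd, hm, g, hg, hfg⟩ := hf
      exact hH f hf0 ⟨g, isMember_spspGeneric_of_mem_spspClass hd hg, hfg⟩

end Literature.Computability.AlgebraicComplexity

end
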